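import Literature.NumberTheory.Automorphic.GLnAdelicStructure
import Mathlib.NumberTheory.NumberField.Units.DirichletTheorem
import Mathlib.LinearAlgebra.FreeModule.IdealQuotient
import Mathlib.GroupTheory.Exponent
import HarnessLib

/-!
# Global units inside `Kˣ`, congruence units `≡ 1 (mod 𝔫)`, and a multiplicatively independent
# system of totally positive congruence units (Dirichlet)

Topic `NumberTheory/Automorphic`; namespace `Literature.NumberTheory.Automorphic`, grouping
sub-namespace `UnitCongruence`.  Definitions with bodies and theorems (no named fact, no `sorry`).
The arithmetic of units needed to sandwich the arithmetic subgroups of the Borel subgroup of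
`GL₂` over a number field `K` between groups `{(a b; 0 d)}` with `a, d` in explicit unit groups
(`ResGL2BorelStabilizerFinite`, `BorelLatticeUnitsCohomologyFinite`):

* `UnitCongruence.globalUnits K ≤ Kˣ` — the image of `(𝓞 K)ˣ`; `mem_globalUnits_iff`: `y` is a
  global unit iff `|y|_v ≤ 1` and `|y⁻¹|_v ≤ 1` at every finite place (then `|y|_v = 1`,
  `valuation_eq_one_of_mem_globalUnits`);
* `UnitCongruence.congruentUnits K 𝔫 ≤ globalUnits K` — the global units with
  `|y − 1|_v ≤ |𝔫|_v` for all `v` (`y ≡ 1 mod 𝔫`), a subgroup by the ultrametric inequality;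
* `mem_ideal_of_forall_valuation_le_idealRadius` — `x ∈ 𝓞 K` with `|x|_v ≤ |𝔫|_v` for all `v`
  lies in `𝔫` (prime-power factorisation, `HeightOneSpectrum.inf_pow_eq_prod`), and conversely
  `valuation_le_idealRadius_of_mem`;
* `UnitCongruence.exponent K 𝔫 = exp((𝓞 K ⧸ 𝔫)ˣ)` (non-zero for `𝔫 ≠ 0`: the quotient is finite)
  and the system `congrUnit K 𝔫 i = ((fundSystem K i)²)^{exp}`, `i : Fin (rank K)`, of SQUARES of
  units congruent to `1 mod 𝔫`: its images `congrUnitK K 𝔫 i ∈ congruentUnits K 𝔫` are totally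
  positive together with all their products (`pos_prod_zpow_congrUnitK`) and MULTIPLICATIVELY
  INDEPENDENT (`eq_zero_of_prod_zpow_congrUnitK_eq_one`, from the uniqueness in Dirichlet's unit
  theorem `NumberField.Units.fun_eq_repr`);
* `UnitCongruence.exists_rep` — every unit is `ζ · ∏ fᵢ^{cᵢ} · ∏ (congrUnit i)^{qᵢ}` with `ζ` a
  root of unity and `0 ≤ cᵢ < 2·exp`: the subgroup generated by the `congrUnit i` has finite index
  in `(𝓞 K)ˣ`, with an explicit finite set of coset representatives.

[cite: Harder1987, §2] (the arithmetic subgroups of `B` and `T`: `Γ ∩ B(ℚ) = Γ_U ⋊ Γ_T`, `Γ_T` a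
congruence subgroup of the units); Dirichlet's unit theorem is Mathlib's
`NumberField.Units.exist_unique_eq_mul_prod`.

## References

* G. Harder, *Eisenstein cohomology of arithmetic groups. The case GL₂*, Invent. Math. 89 (1987), §2
  [Harder1987].
* J. Neukirch, *Algebraic Number Theory* (1999), Ch. I §7 (Dirichlet's unit theorem), §11
  [NeukirchANT1999].
-/

noncomputable section

open scoped NumberField
open IsDedekindDomain NumberField

namespace Literature.NumberTheory.Automorphic

namespace UnitCongruence

variable (K : Type) [Field K] [NumberField K]

/-! ### Global units in `Kˣ` -/

/-- **The global units `(𝓞 K)ˣ` as a subgroup of `Kˣ`** (image of `Units.map (𝓞 K → K)`).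
[folklore] -/
def globalUnits : Subgroup Kˣ :=
  (Units.map (algebraMap (𝓞 K) K : 𝓞 K →* K)).range

variable {K}

omit [NumberField K] in
/-- The image of a unit of `𝓞 K` is a global unit (definitional). [folklore] -/
theorem map_mem_globalUnits (x : (𝓞 K)ˣ) : Units.map (algebraMap (𝓞 K) K : 𝓞 K →* K) x ∈ globalUnits K :=
  ⟨x, rfl⟩

/-- A global unit is integral at every finite place, together with its inverse. [folklore] -/
theorem valuation_le_one_of_mem_globalUnits {y : Kˣ} (hy : y ∈ globalUnits K) (v : HeightOneSpectrum (𝓞 K)) :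
    v.valuation K (y : K) ≤ 1 ∧ v.valuation K ((y⁻¹ : Kˣ) : K) ≤ 1 := by
  obtain ⟨x, rfl⟩ := hy
  rw [← map_inv]
  exact ⟨v.valuation_le_one (x : 𝓞 K), v.valuation_le_one ((x⁻¹ : (𝓞 K)ˣ) : 𝓞 K)⟩

/-- **Local characterisation of the global units**: `y ∈ Kˣ` is a global unit iff `|y|_v ≤ 1` and
`|y⁻¹|_v ≤ 1` for all finite places `v`. [cite: NeukirchANT1999, Ch. I §11] -/
theorem mem_globalUnits_iff {y : Kˣ} :
    y ∈ globalUnits K ↔ (∀ v : HeightOneSpectrum (𝓞 K), v.valuation K (y : K) ≤ 1) ∧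
      ∀ v : HeightOneSpectrum (𝓞 K), v.valuation K ((y⁻¹ : Kˣ) : K) ≤ 1 := by
  constructor
  · intro hy
    exact ⟨fun v => (valuation_le_one_of_mem_globalUnits hy v).1,
      fun v => (valuation_le_one_of_mem_globalUnits hy v).2⟩
  · rintro ⟨h1, h2⟩
    obtain ⟨r, hr⟩ := HeightOneSpectrum.mem_integers_of_valuation_le_one K (y : K) h1
    obtain ⟨r', hr'⟩ := HeightOneSpectrum.mem_integers_of_valuation_le_one K ((y⁻¹ : Kˣ) : K) h2
    have hrr' : r * r' = 1 := by
      apply RingOfIntegers.coe_injective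
      rw [map_mul, map_one, hr, hr', ← Units.val_mul, mul_inv_cancel, Units.val_one]
    have hr'r : r' * r = 1 := by rw [mul_comm]; exact hrr'
    refine ⟨⟨r, r', hrr', hr'r⟩, Units.ext ?_⟩
    rw [Units.coe_map, MonoidHom.coe_coe]
    exact hr

/-- A global unit has valuation `1` at every finite place. [folklore] -/
theorem valuation_eq_one_of_mem_globalUnits {y : Kˣ} (hy : y ∈ globalUnits K) (v : HeightOneSpectrum (𝓞 K)) :
    v.valuation K (y : K) = 1 := by
  obtain ⟨h1, h2⟩ := valuation_le_one_of_mem_globalUnits hy v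
  refine le_antisymm h1 ?_
  have hprod : v.valuation K (y : K) * v.valuation K ((y⁻¹ : Kˣ) : K) = 1 := by
    rw [← map_mul, ← Units.val_mul, mul_inv_cancel, Units.val_one, map_one]
  calc (1 : WithZero (Multiplicative ℤ)) = v.valuation K (y : K) * v.valuation K ((y⁻¹ : Kˣ) : K) := hprod.symm
    _ ≤ v.valuation K (y : K) * 1 := mul_le_mul_right h2 _
    _ = v.valuation K (y : K) := mul_one _

/-! ### Membership in `𝔫` from the local radii `|𝔫|_v` -/

/-- **`c ∈ 𝔫 ⟹ |c|_v ≤ |𝔫|_v`** for every finite place. [cite: NeukirchANT1999, Ch. I §11] -/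
theorem valuation_le_idealRadius_of_mem {𝔫 : Ideal (𝓞 K)} (h𝔫 : 𝔫 ≠ 0) {c : 𝓞 K} (hc : c ∈ 𝔫)
    (v : HeightOneSpectrum (𝓞 K)) : v.valuation K (c : K) ≤ idealRadius K v 𝔫 := by
  classical
  rw [show (c : K) = algebraMap (𝓞 K) K c from rfl, v.valuation_of_algebraMap]
  set e : ℕ := (Associates.mk v.asIdeal).count (Associates.mk 𝔫).factors with he
  have hrad : idealRadius K v 𝔫 = WithZero.exp (-(e : ℤ)) := by
    rw [idealRadius, FractionalIdeal.count_coe K v h𝔫]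
  rw [hrad, HeightOneSpectrum.intValuation_le_pow_iff_mem]
  have hdvd : v.asIdeal ^ e ∣ 𝔫 := by
    rw [← Associates.mk_le_mk_iff_dvd, Associates.mk_pow]
    exact (Associates.prime_pow_dvd_iff_le (Associates.mk_ne_zero.mpr h𝔫)
      v.associates_irreducible).mpr le_rfl
  exact Ideal.le_of_dvd hdvd hc

/-- **`|x|_v ≤ |𝔫|_v` for all `v` ⟹ `x ∈ 𝔫`** (`x ∈ 𝓞 K`): `x` lies in every prime power
`𝔭_v^{ord_v 𝔫}`, whose intersection over the finitely many `v ∣ 𝔫` is their product `𝔫`.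
[cite: NeukirchANT1999, Ch. I §11] -/
theorem mem_ideal_of_forall_valuation_le_idealRadius {𝔫 : Ideal (𝓞 K)} (h𝔫 : 𝔫 ≠ 0) {x : 𝓞 K}
    (h : ∀ v : HeightOneSpectrum (𝓞 K), v.valuation K (x : K) ≤ idealRadius K v 𝔫) : x ∈ 𝔫 := by
  classical
  -- `x ∈ 𝔭_v ^ ord_v 𝔫` for every `v`
  have hmem : ∀ v : HeightOneSpectrum (𝓞 K), x ∈ v.maxPowDividing 𝔫 := fun v => by
    have hv := h v
    rw [show (x : K) = algebraMap (𝓞 K) K x from rfl, v.valuation_of_algebraMap, idealRadius,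
      FractionalIdeal.count_coe K v h𝔫, HeightOneSpectrum.intValuation_le_pow_iff_mem] at hv
    exact hv
  -- the finite set of prime factors of `𝔫`
  set s := (Ideal.finite_factors h𝔫).toFinset with hs
  have hsupp : Function.mulSupport (fun v : HeightOneSpectrum (𝓞 K) => v.maxPowDividing 𝔫) ⊆ s := by
    intro v hv
    rw [Function.mem_mulSupport] at hv
    rw [hs, Set.Finite.coe_toFinset]
    by_contra hdvd
    apply hv
    have h0 : (Associates.mk v.asIdeal).count (Associates.mk 𝔫).factors = 0 := by
      by_contra h'
      exact hdvd ((Associates.count_ne_zero_iff_dvd h𝔫 v.irreducible).mp h')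
    rw [HeightOneSpectrum.maxPowDividing, h0, pow_zero, Ideal.one_eq_top]
  rw [← Ideal.finprod_heightOneSpectrum_factorization h𝔫, finprod_eq_prod_of_mulSupport_subset _ hsupp]
  -- `∏_{v ∈ s} 𝔭_v^{e_v} = ⨅_{v ∈ s} 𝔭_v^{e_v}`
  have hinf := HeightOneSpectrum.inf_pow_eq_prod s
    (fun v : HeightOneSpectrum (𝓞 K) => (Associates.mk v.asIdeal).count (Associates.mk 𝔫).factors)
    (fun v => v) (fun i _ j _ hij => hij)
  change x ∈ ∏ v ∈ s, v.asIdeal ^ (Associates.mk v.asIdeal).count (Associates.mk 𝔫).factors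
  rw [← hinf, Submodule.mem_finsetInf]
  exact fun v _ => hmem v

/-! ### Units congruent to `1 mod 𝔫` -/

variable (K)

/-- **The congruence units `{y ∈ (𝓞 K)ˣ : y ≡ 1 (mod 𝔫)}` inside `Kˣ`**: global units with
`|y − 1|_v ≤ |𝔫|_v` at every finite place (a subgroup: `yz − 1 = (y − 1)z + (z − 1)`,
`y⁻¹ − 1 = −y⁻¹(y − 1)` and `|z|_v = |y⁻¹|_v = 1`). [cite: Harder1987, §2] -/
def congruentUnits (𝔫 : Ideal (𝓞 K)) : Subgroup Kˣ where
  carrier := {y | y ∈ globalUnits K ∧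
    ∀ v : HeightOneSpectrum (𝓞 K), v.valuation K ((y : K) - 1) ≤ idealRadius K v 𝔫}
  one_mem' := ⟨Subgroup.one_mem _, fun v => by rw [Units.val_one, sub_self, map_zero]; exact zero_le⟩
  mul_mem' := by
    rintro y z ⟨hy, hy'⟩ ⟨hz, hz'⟩
    refine ⟨Subgroup.mul_mem _ hy hz, fun v => ?_⟩
    have hsplit : ((y * z : Kˣ) : K) - 1 = ((y : K) - 1) * (z : K) + ((z : K) - 1) := by
      rw [Units.val_mul]; ring
    rw [hsplit]
    refine (Valuation.map_add _ _ _).trans (max_le ?_ (hz' v))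
    rw [map_mul, valuation_eq_one_of_mem_globalUnits hz v, mul_one]
    exact hy' v
  inv_mem' := by
    rintro y ⟨hy, hy'⟩
    refine ⟨Subgroup.inv_mem _ hy, fun v => ?_⟩
    have hsplit : ((y⁻¹ : Kˣ) : K) - 1 = -(((y⁻¹ : Kˣ) : K) * ((y : K) - 1)) := by
      rw [mul_sub, mul_one, ← Units.val_mul, inv_mul_cancel, Units.val_one]; ring
    rw [hsplit, Valuation.map_neg, map_mul, valuation_eq_one_of_mem_globalUnits (Subgroup.inv_mem _ hy) v,
      one_mul]
    exact hy' v

variable {K}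

/-- Membership in `congruentUnits` (definitional). [folklore] -/
theorem mem_congruentUnits_iff {𝔫 : Ideal (𝓞 K)} {y : Kˣ} :
    y ∈ congruentUnits K 𝔫 ↔ y ∈ globalUnits K ∧
      ∀ v : HeightOneSpectrum (𝓞 K), v.valuation K ((y : K) - 1) ≤ idealRadius K v 𝔫 :=
  Iff.rfl

/-- `congruentUnits K 𝔫 ≤ globalUnits K`. [folklore] -/
theorem congruentUnits_le_globalUnits (𝔫 : Ideal (𝓞 K)) : congruentUnits K 𝔫 ≤ globalUnits K :=
  fun _ hy => hy.1

/-- A unit `x ∈ (𝓞 K)ˣ` with `x − 1 ∈ 𝔫` gives a congruence unit. [cite: Harder1987, §2] -/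
theorem map_mem_congruentUnits {𝔫 : Ideal (𝓞 K)} (h𝔫 : 𝔫 ≠ 0) {x : (𝓞 K)ˣ} (hx : (x : 𝓞 K) - 1 ∈ 𝔫) :
    Units.map (algebraMap (𝓞 K) K : 𝓞 K →* K) x ∈ congruentUnits K 𝔫 := by
  refine ⟨map_mem_globalUnits x, fun v => ?_⟩
  have h := valuation_le_idealRadius_of_mem h𝔫 hx v
  rw [Units.coe_map, MonoidHom.coe_coe]
  convert h using 2
  simp

/-! ### The exponent of `(𝓞 K ⧸ 𝔫)ˣ` and the congruence units `((f_i)²)^{exp}` -/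

variable (K)

/-- The exponent of the finite group `(𝓞 K ⧸ 𝔫)ˣ`. [folklore] -/
def exponent (𝔫 : Ideal (𝓞 K)) : ℕ :=
  Monoid.exponent ((𝓞 K ⧸ 𝔫)ˣ)

variable {K} in
/-- For `𝔫 ≠ 0` the quotient `𝓞 K ⧸ 𝔫` is finite, so the exponent of its unit group is non-zero.
[cite: NeukirchANT1999, Ch. I §11] -/
theorem exponent_ne_zero {𝔫 : Ideal (𝓞 K)} (h𝔫 : 𝔫 ≠ 0) : exponent K 𝔫 ≠ 0 := by
  haveI : Finite (𝓞 K ⧸ 𝔫) := Ideal.finiteQuotientOfFreeOfNeBot 𝔫 h𝔫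
  exact Monoid.exponent_ne_zero_of_finite

variable {K} in
omit [NumberField K] in
/-- **`x^{exp} ≡ 1 (mod 𝔫)`** for every unit `x` of `𝓞 K`. [folklore] -/
theorem pow_exponent_sub_one_mem (𝔫 : Ideal (𝓞 K)) (x : (𝓞 K)ˣ) :
    ((x ^ exponent K 𝔫 : (𝓞 K)ˣ) : 𝓞 K) - 1 ∈ 𝔫 := by
  have h := Monoid.pow_exponent_eq_one (Units.map (Ideal.Quotient.mk 𝔫 : 𝓞 K →* 𝓞 K ⧸ 𝔫) x)
  rw [← map_pow] at h
  have h' := congrArg (fun u : (𝓞 K ⧸ 𝔫)ˣ => (u : 𝓞 K ⧸ 𝔫)) h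
  simp only [Units.coe_map, MonoidHom.coe_coe, Units.val_one] at h'
  rw [← Ideal.Quotient.eq_zero_iff_mem, map_sub, map_one, sub_eq_zero]
  exact h'

/-- **The congruence units `u_i = ((f_i)²)^{exp} ∈ (𝓞 K)ˣ`** built from Mathlib's fundamental
system `fundSystem K : Fin (rank K) → (𝓞 K)ˣ`: squares (hence totally positive) and `≡ 1 mod 𝔫`.
[cite: Harder1987, §2] -/
def congrUnit (𝔫 : Ideal (𝓞 K)) (i : Fin (Units.rank K)) : (𝓞 K)ˣ :=
  (Units.fundSystem K i ^ 2) ^ exponent K 𝔫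

/-- The congruence units in `Kˣ`. [folklore] -/
def congrUnitK (𝔫 : Ideal (𝓞 K)) (i : Fin (Units.rank K)) : Kˣ :=
  Units.map (algebraMap (𝓞 K) K : 𝓞 K →* K) (congrUnit K 𝔫 i)

variable {K}

/-- `u_i ∈ congruentUnits K 𝔫` (`𝔫 ≠ 0`). [cite: Harder1987, §2] -/
theorem congrUnitK_mem_congruentUnits {𝔫 : Ideal (𝓞 K)} (h𝔫 : 𝔫 ≠ 0) (i : Fin (Units.rank K)) :
    congrUnitK K 𝔫 i ∈ congruentUnits K 𝔫 :=
  map_mem_congruentUnits h𝔫 (pow_exponent_sub_one_mem 𝔫 _)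

/-- `u_i` is a global unit. [folklore] -/
theorem congrUnitK_mem_globalUnits (𝔫 : Ideal (𝓞 K)) (i : Fin (Units.rank K)) :
    congrUnitK K 𝔫 i ∈ globalUnits K :=
  map_mem_globalUnits _

/-- `u_i = w_i²` with `w_i = f_i^{exp}` in `Kˣ`. [folklore] -/
theorem congrUnitK_eq_sq (𝔫 : Ideal (𝓞 K)) (i : Fin (Units.rank K)) :
    congrUnitK K 𝔫 i = (Units.map (algebraMap (𝓞 K) K : 𝓞 K →* K) (Units.fundSystem K i ^ exponent K 𝔫)) ^ 2 := by
  rw [congrUnitK, congrUnit, ← map_pow]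
  congr 1
  rw [← pow_mul, ← pow_mul, mul_comm]

omit [NumberField K] in
/-- A product of integer powers of squares is a square. [folklore] -/
theorem prod_zpow_sq {ι : Type*} (s : Finset ι) (w : ι → Kˣ) (e : ι → ℤ) :
    ∏ i ∈ s, (w i ^ 2) ^ e i = (∏ i ∈ s, w i ^ e i) ^ 2 := by
  rw [← Finset.prod_pow]
  exact Finset.prod_congr rfl fun i _ => by rw [← zpow_natCast, ← zpow_natCast, ← zpow_mul, ← zpow_mul, mul_comm]

/-- **Products of powers of the `u_i` are totally positive**: they are squares of non-zero elements.
[cite: Harder1987, §2] -/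
theorem pos_prod_zpow_congrUnitK (𝔫 : Ideal (𝓞 K)) (e : Fin (Units.rank K) → ℤ) (τ : K →+* ℝ) :
    0 < τ ((∏ i, congrUnitK K 𝔫 i ^ e i : Kˣ) : K) := by
  have hsq : ∏ i, congrUnitK K 𝔫 i ^ e i =
      (∏ i, (Units.map (algebraMap (𝓞 K) K : 𝓞 K →* K) (Units.fundSystem K i ^ exponent K 𝔫)) ^ e i) ^ 2 := by
    rw [← prod_zpow_sq]
    exact Finset.prod_congr rfl fun i _ => by rw [congrUnitK_eq_sq]
  rw [hsq, Units.val_pow_eq_pow_val, map_pow]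
  have hne : τ ((∏ i, (Units.map (algebraMap (𝓞 K) K : 𝓞 K →* K) (Units.fundSystem K i ^ exponent K 𝔫)) ^ e i :
      Kˣ) : K) ≠ 0 := (map_ne_zero τ).2 (Units.ne_zero _)
  exact lt_of_le_of_ne (sq_nonneg _) (pow_ne_zero 2 hne).symm

omit [NumberField K] in
/-- `Units.map (𝓞 K → K)` is injective. [folklore] -/
theorem unitsMap_injective : Function.Injective (Units.map (algebraMap (𝓞 K) K : 𝓞 K →* K)) := by
  intro x y h
  refine Units.ext (RingOfIntegers.coe_injective ?_)
  have h' := congrArg (fun u : Kˣ => (u : K)) h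
  simpa [Units.coe_map] using h'

/-- **Multiplicative independence of the `u_i`** (`𝔫 ≠ 0`): `∏ u_i^{e_i} = 1` forces `e = 0`, by
the uniqueness of the exponents in Dirichlet's unit theorem (`NumberField.Units.fun_eq_repr`).
[cite: NeukirchANT1999, Ch. I §7] -/
theorem eq_zero_of_prod_zpow_congrUnitK_eq_one {𝔫 : Ideal (𝓞 K)} (h𝔫 : 𝔫 ≠ 0)
    (e : Fin (Units.rank K) → ℤ) (he : ∏ i, congrUnitK K 𝔫 i ^ e i = 1) : e = 0 := by
  -- back to `(𝓞 K)ˣ`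
  have he' : ∏ i, congrUnit K 𝔫 i ^ e i = 1 := by
    apply unitsMap_injective
    rw [map_prod, map_one]
    simp only [map_zpow]
    exact he
  -- `∏ f_i^{2 exp e_i} = 1 = 1 · ∏ f_i^{…}`
  have hrepr : (1 : (𝓞 K)ˣ) = 1 * ∏ i, Units.fundSystem K i ^ ((2 * (exponent K 𝔫 : ℤ)) * e i) := by
    rw [one_mul, ← he']
    refine Finset.prod_congr rfl fun i _ => ?_
    rw [congrUnit, ← zpow_natCast, ← zpow_natCast, ← zpow_mul, ← zpow_mul]
    congr 1
    push_cast
    ring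
  have hfun := Units.fun_eq_repr (K := K) (Subgroup.one_mem _) hrepr
  rw [QuotientGroup.mk_one, ofMul_one, map_zero, Finsupp.coe_zero] at hfun
  funext i
  have hi : 2 * (exponent K 𝔫 : ℤ) * e i = 0 := congrFun hfun i
  rcases mul_eq_zero.mp hi with hi | hi
  · rcases mul_eq_zero.mp hi with h2 | h2
    · exact absurd h2 two_ne_zero
    · exact absurd (by exact_mod_cast h2) (exponent_ne_zero h𝔫)
  · exact hi

/-- **Finitely many cosets**: every unit of `𝓞 K` is `ζ · ∏ f_i^{c_i} · ∏ u_i^{q_i}` with `ζ` a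
root of unity, `0 ≤ c_i < 2 exp` and `q_i ∈ ℤ` (`𝔫 ≠ 0`) — the subgroup generated by the `u_i` has
finite index in `(𝓞 K)ˣ`, with representatives `ζ ∏ f_i^{c_i}`. [cite: NeukirchANT1999, Ch. I §7] -/
theorem exists_rep {𝔫 : Ideal (𝓞 K)} (h𝔫 : 𝔫 ≠ 0) (x : (𝓞 K)ˣ) :
    ∃ ζ ∈ Units.torsion K, ∃ c : Fin (Units.rank K) → Fin (2 * exponent K 𝔫), ∃ q : Fin (Units.rank K) → ℤ,
      x = ζ * (∏ i, Units.fundSystem K i ^ ((c i : ℕ) : ℤ)) * ∏ i, congrUnit K 𝔫 i ^ q i := by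
  obtain ⟨⟨ζ, f⟩, hx, -⟩ := Units.exist_unique_eq_mul_prod K x
  have hM : (0 : ℤ) < (2 * exponent K 𝔫 : ℕ) := by
    have := exponent_ne_zero (K := K) h𝔫
    omega
  -- `f_i = M q_i + c_i`
  refine ⟨ζ, ζ.2, fun i => ⟨(f i % (2 * exponent K 𝔫 : ℕ)).toNat, ?_⟩, fun i => f i / (2 * exponent K 𝔫 : ℕ), ?_⟩
  · have h0 := Int.emod_nonneg (f i) hM.ne'
    have h1 := Int.emod_lt_of_pos (f i) hM
    omega
  · rw [hx, mul_assoc, ← Finset.prod_mul_distrib]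
    congr 1
    refine Finset.prod_congr rfl fun i _ => ?_
    have h0 := Int.emod_nonneg (f i) hM.ne'
    rw [Int.toNat_of_nonneg h0, congrUnit, ← zpow_natCast (Units.fundSystem K i ^ 2), ← zpow_natCast,
      ← zpow_mul, ← zpow_mul, ← zpow_add]
    congr 1
    push_cast
    have := Int.emod_add_mul_ediv (f i) (2 * exponent K 𝔫 : ℕ)
    push_cast at this
    linarith

end UnitCongruence

end Literature.NumberTheory.Automorphic

end
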